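import Literature.Algebra.Homology.DiscreteRepStandardResolutionNaturality
import HarnessLib

/-!
# The long exact sequence of continuous cohomology for discrete modules over a compact group

Topic `Algebra/Homology`; namespace `Literature.Algebra.Homology.DiscreteRep`.  Sequel of
`DiscreteRepStandardResolution` (the comparison `Φ : Extⁿ_{C_Γ}(k, X) ≃+ Hⁿ_cont(Γ, X)`) and
`DiscreteRepStandardResolutionNaturality` (its naturality in `X`); no named fact, no `sorry`.

Mathlib's `continuousCohomology` (homogeneous continuous cochains) has no long exact sequence yet
(`Mathlib/RepresentationTheory/Homological/ContCohomology/Basic.lean`, TODO "Show that short exact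
sequences induce long exact sequences in certain scenarios").  For a COMPACT topological group `Γ` and
a short exact sequence `0 → X₁ —f→ X₂ —g→ X₃ → 0` of topologically DISCRETE `k`-linear
representations with open stabilisers (exactness = injectivity of `f`, surjectivity of `g`,
`ker g = im f` on vectors) we TRANSPORT Mathlib's long exact `Ext`-sequence in the abelian category
`C_Γ` (`Ext.covariant_sequence_exact₁/₂/₃`) along the natural isomorphisms `Φ`:

* `connectingHom f g … n : Hⁿ_cont(Γ, X₃) →+ Hⁿ⁺¹_cont(Γ, X₁)` — the connecting homomorphism,
  DEFINED as `Φ ∘ (· ∘ [S]) ∘ Φ⁻¹` (`[S] ∈ Ext¹(X₃, X₁)` the class of the sequence);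
* exactness at `Hⁿ(X₂)` (`continuousCohomology_exact₂`), at `Hⁿ(X₃)` (`continuousCohomology_exact₃`)
  and at `Hⁿ⁺¹(X₁)` (`continuousCohomology_exact₁`), with `Hⁿ(f)`, `Hⁿ(g)` Mathlib's
  `ContinuousCohomology.map (ContinuousMonoidHom.id Γ)`.

(Harari, *Galois Cohomology and Class Field Theory*, Thm. 1.17 / §4.3 for profinite groups; Serre,
*Galois Cohomology* I §2.2.)  Galois case: `galoisCohomology` of a number/local field (`Γ_K` compact).

## References
* D. Harari, *Galois Cohomology and Class Field Theory* (2020), Thm. 1.17, §4.3. [Harari2020]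
* J.-P. Serre, *Galois Cohomology*, Springer (1997), I §2.2. [SerreGaloisCohomology1997]
-/

noncomputable section

universe u

namespace Literature.Algebra.Homology

namespace DiscreteRep

open CategoryTheory CategoryTheory.Limits CategoryTheory.Abelian TopRep ContRepresentation
  ContinuousCohomology

variable {k Γ : Type u} [CommRing k] [TopologicalSpace k] [Group Γ] [TopologicalSpace Γ]
  [IsTopologicalGroup Γ] [CompactSpace Γ]
  {X₁ X₂ X₃ : TopRep.{u} k Γ} [DiscreteTopology X₁.V] [DiscreteTopology X₂.V] [DiscreteTopology X₃.V]
  (h₁ : IsDiscrete ((forgetTop k Γ).obj X₁)) (h₂ : IsDiscrete ((forgetTop k Γ).obj X₂))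
  (h₃ : IsDiscrete ((forgetTop k Γ).obj X₃))
  (f : X₁ ⟶ X₂) (g : X₂ ⟶ X₃) (hfg : ∀ x, g.hom (f.hom x) = 0) (hf : Function.Injective f.hom)
  (hg : Function.Surjective g.hom) (hex : ∀ y, g.hom y = 0 → ∃ x, f.hom x = y)

/-! ## §1 The short exact sequence in `C_Γ` -/

include hfg in
/-- `f ≫ g = 0` in `C_Γ`. [cite: Harari2020, §4.2] -/
theorem stdBaseMap_comp_eq_zero : stdBaseMap h₁ h₂ f ≫ stdBaseMap h₂ h₃ g = 0 :=
  ObjectProperty.hom_ext _ (Rep.hom_ext (DFunLike.ext _ _ fun x => hfg x))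

/-- The short complex `0 → X₁ → X₂ → X₃ → 0` in `C_Γ`. [cite: Harari2020, §4.2] -/
abbrev shortComplex : ShortComplex (DiscreteRepCat k Γ) :=
  ShortComplex.mk (stdBaseMap h₁ h₂ f) (stdBaseMap h₂ h₃ g) (stdBaseMap_comp_eq_zero h₁ h₂ h₃ f g hfg)

include hf hg hex in
/-- It is short exact. [cite: Harari2020, §4.2] -/
theorem shortComplex_shortExact : (shortComplex h₁ h₂ h₃ f g hfg).ShortExact where
  exact := shortComplex_exact_of_forall _ _ _ fun y hy => hex y hy
  mono_f := by
    apply (ι k Γ).mono_of_mono_map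
    rw [Rep.mono_iff_injective]
    exact hf
  epi_g := by
    apply (ι k Γ).epi_of_epi_map
    rw [Rep.epi_iff_surjective]
    exact hg

/-! ## §2 The connecting homomorphism -/

/-- **The connecting homomorphism `δ : Hⁿ_cont(Γ, X₃) →+ Hⁿ⁺¹_cont(Γ, X₁)`** of the short exact
sequence, transported from `Ext` (`x ↦ x ∘ [S]`) along the comparison isomorphisms `Φ`.
[cite: Harari2020, Theorem 1.17] -/
def connectingHom (n : ℕ) :
    (continuousCohomology n X₃ : TopModuleCat.{u} k) →+
      (continuousCohomology (n + 1) X₁ : TopModuleCat.{u} k) :=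
  ((extTrivAddEquivContinuousCohomology X₁ h₁ (n + 1)).toAddMonoidHom.comp
    ((shortComplex_shortExact h₁ h₂ h₃ f g hfg hf hg hex).extClass.postcomp
      (triv (Γ := Γ) k) (rfl : n + 1 = n + 1))).comp
    (extTrivAddEquivContinuousCohomology X₃ h₃ n).symm.toAddMonoidHom

/-- `δ ∘ Φ₃ = Φ₁ ∘ (· ∘ [S])`. [cite: Harari2020, Theorem 1.17] -/
theorem connectingHom_comp (n : ℕ) :
    (connectingHom h₁ h₂ h₃ f g hfg hf hg hex n).comp
        (extTrivAddEquivContinuousCohomology X₃ h₃ n : _ →+ _) =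
      (extTrivAddEquivContinuousCohomology X₁ h₁ (n + 1) : _ →+ _).comp
        ((shortComplex_shortExact h₁ h₂ h₃ f g hfg hf hg hex).extClass.postcomp
          (triv (Γ := Γ) k) (rfl : n + 1 = n + 1)) := by
  ext x
  simp [connectingHom]

/-! ## §3 The maps `Hⁿ(f)`, `Hⁿ(g)` and the commuting squares -/

/-- `Hⁿ(f)` on underlying groups (Mathlib's `ContinuousCohomology.map (id Γ) f`).
[cite: Harari2020, §4.3] -/
abbrev cohomologyMapHom {X Y : TopRep.{u} k Γ} (φ : X ⟶ Y) (n : ℕ) :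
    (continuousCohomology n X : TopModuleCat.{u} k) →+ (continuousCohomology n Y : TopModuleCat.{u} k) :=
  (ContinuousCohomology.map (ContinuousMonoidHom.id Γ) (X := X) (Y := Y) φ n).hom.toLinearMap.toAddMonoidHom

/-- The square for `Hⁿ(φ)`: `Hⁿ(φ) ∘ Φ_X = Φ_Y ∘ φ_*` (the naturality file, as an equality of
additive homomorphisms). [cite: Harari2020, §4.3, Remark 4.24] -/
theorem cohomologyMapHom_comp {X Y : TopRep.{u} k Γ} [DiscreteTopology X.V] [DiscreteTopology Y.V]
    (hX : IsDiscrete ((forgetTop k Γ).obj X)) (hY : IsDiscrete ((forgetTop k Γ).obj Y)) (φ : X ⟶ Y)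
    (n : ℕ) :
    (cohomologyMapHom φ n).comp (extTrivAddEquivContinuousCohomology X hX n : _ →+ _) =
      (extTrivAddEquivContinuousCohomology Y hY n : _ →+ _).comp
        ((Ext.mk₀ (stdBaseMap hX hY φ)).postcomp (triv (Γ := Γ) k) (add_zero n)) :=
  AddMonoidHom.ext fun x => extTrivAddEquivContinuousCohomology_naturality hX hY φ n x

/-! ## §4 Exactness -/

include h₁ h₂ h₃ hfg hf hg hex in
/-- **Exactness at `Hⁿ(X₂)`: `Hⁿ(X₁) → Hⁿ(X₂) → Hⁿ(X₃)` is exact.** [cite: Harari2020, Theorem 1.17] -/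
theorem continuousCohomology_exact₂ (n : ℕ) :
    Function.Exact (cohomologyMapHom f n) (cohomologyMapHom g n) := by
  have H := Ext.covariant_sequence_exact₂' (triv (Γ := Γ) k)
    (shortComplex_shortExact h₁ h₂ h₃ f g hfg hf hg hex) n
  rw [ShortComplex.ab_exact_iff_function_exact] at H
  exact Function.Exact.of_ladder_addEquiv_of_exact
    (extTrivAddEquivContinuousCohomology X₁ h₁ n) (extTrivAddEquivContinuousCohomology X₂ h₂ n)
    (extTrivAddEquivContinuousCohomology X₃ h₃ n)
    (cohomologyMapHom_comp h₁ h₂ f n) (cohomologyMapHom_comp h₂ h₃ g n) H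

/-- **Exactness at `Hⁿ(X₃)`: `Hⁿ(X₂) → Hⁿ(X₃) —δ→ Hⁿ⁺¹(X₁)` is exact.** [cite: Harari2020, Theorem 1.17] -/
theorem continuousCohomology_exact₃ (n : ℕ) :
    Function.Exact (cohomologyMapHom g n) (connectingHom h₁ h₂ h₃ f g hfg hf hg hex n) := by
  have H := Ext.covariant_sequence_exact₃' (triv (Γ := Γ) k)
    (shortComplex_shortExact h₁ h₂ h₃ f g hfg hf hg hex) n (n + 1) rfl
  rw [ShortComplex.ab_exact_iff_function_exact] at H
  exact Function.Exact.of_ladder_addEquiv_of_exact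
    (extTrivAddEquivContinuousCohomology X₂ h₂ n) (extTrivAddEquivContinuousCohomology X₃ h₃ n)
    (extTrivAddEquivContinuousCohomology X₁ h₁ (n + 1))
    (cohomologyMapHom_comp h₂ h₃ g n) (connectingHom_comp h₁ h₂ h₃ f g hfg hf hg hex n) H

/-- **Exactness at `Hⁿ⁺¹(X₁)`: `Hⁿ(X₃) —δ→ Hⁿ⁺¹(X₁) → Hⁿ⁺¹(X₂)` is exact.**
[cite: Harari2020, Theorem 1.17] -/
theorem continuousCohomology_exact₁ (n : ℕ) :
    Function.Exact (connectingHom h₁ h₂ h₃ f g hfg hf hg hex n) (cohomologyMapHom f (n + 1)) := by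
  have H := Ext.covariant_sequence_exact₁' (triv (Γ := Γ) k)
    (shortComplex_shortExact h₁ h₂ h₃ f g hfg hf hg hex) n (n + 1) rfl
  rw [ShortComplex.ab_exact_iff_function_exact] at H
  exact Function.Exact.of_ladder_addEquiv_of_exact
    (extTrivAddEquivContinuousCohomology X₃ h₃ n) (extTrivAddEquivContinuousCohomology X₁ h₁ (n + 1))
    (extTrivAddEquivContinuousCohomology X₂ h₂ (n + 1))
    (connectingHom_comp h₁ h₂ h₃ f g hfg hf hg hex n) (cohomologyMapHom_comp h₁ h₂ f (n + 1)) H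

include h₁ h₂ h₃ g hfg hf hg hex in
/-- In degree `0` nothing maps in: **`H⁰(X₁) → H⁰(X₂)` is injective.** [cite: Harari2020, Theorem 1.17] -/
theorem cohomologyMapHom_zero_injective : Function.Injective (cohomologyMapHom f 0) := by
  intro a b hab
  have hS := shortComplex_shortExact h₁ h₂ h₃ f g hfg hf hg hex
  haveI := hS.mono_f
  apply (extTrivAddEquivContinuousCohomology X₁ h₁ 0).symm.injective
  apply Ext.postcomp_mk₀_injective_of_mono (triv (Γ := Γ) k) (stdBaseMap h₁ h₂ f)
  apply (extTrivAddEquivContinuousCohomology X₂ h₂ 0).injective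
  have e := fun x => extTrivAddEquivContinuousCohomology_naturality h₁ h₂ f 0 x
  change extTrivAddEquivContinuousCohomology X₂ h₂ 0 ((Ext.mk₀ (stdBaseMap h₁ h₂ f)).postcomp _ _ _) =
    extTrivAddEquivContinuousCohomology X₂ h₂ 0 ((Ext.mk₀ (stdBaseMap h₁ h₂ f)).postcomp _ _ _)
  erw [← e, ← e, AddEquiv.apply_symm_apply, AddEquiv.apply_symm_apply]
  exact hab

end DiscreteRep

end Literature.Algebra.Homology
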